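import Literature.NumberTheory.LFunctions.FamilyNonvanishingLandauSiegel
import Literature.NumberTheory.EllipticCurves.NewformsFiniteProofs
import HarnessLib

/-!
# The second moment of `L(½, f × χ)` over newforms, uniformly in weight, level and conductor
# (L. Yang, Trans. AMS 378 (2025) = arXiv:2307.05571, Corollary 1.2)

Topic `Literature/NumberTheory/LFunctions` (namespace `Literature.NumberTheory.LFunctions`).
STATEMENT LAYER (D-0014): ONE named fact — Corollary 1.2 of the source — over the tree's
`IwaniecSarnak.twistedCentralValue` (`L(½, f ⊗ χ)`, analytic normalisation) summed over the tree's
set of normalised newforms `newforms0 N k` (finite: `finite_newforms0_holds`), no harmonic weights.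
Typed for the cell `landau-siegel` (LS programme F-S3 §C, HARVEST T-115, tag E*-fam; consumer named
by ls-lit-lead 2026-08-26T17:11Z/17:42Z: the a-priori (large-values) bound of record for every
B-fam mollified first/second-moment design — an UPPER bound uniform in `(k,N,q)`, Lindelöf on
average over the family of size `≍ kN` once `N ≥ q^{2+}`; it has no main term, no mollifier and no
root-number split, so it is an input, never a `½`-proportion statement).

## What the source prints (held text `paper:arxiv-2307.05571` = arXiv v1, p0002:L51–p0003:L5, read 2026-08-26)

L. Yang, *Average of central `L`-values for GL(2)×GL(1), hybrid subconvexity, and simultaneous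
nonvanishing*, Trans. Amer. Math. Soc. 378 (2025), no. 12, 8391–8435 [YangLiyang2025TAMS]
(= arXiv:2307.05571; numbering of the arXiv text). "For `F = ℚ`, with `Π_∞` being a holomorphic
discrete series of SL(2), and `χ` as a Dirichlet character, Theorem A implies the following.

> **Corollary 1.2.** Let `k ≥ 2` and `N ≥ 1`. Let `χ` be a primitive Dirichlet character modulo `q`.
> Then `Σ_{f ∈ F_k^{new}(N)} |L(1/2, f × χ)|² ≪ (kNq)^ε (kN + k^{1/2} q · 1_{N ≪ q² gcd(N,q)})`, (1.2)
> where the implied constant depends only on `ε`. Here `F_k^{new}(N)` is an orthogonal basis of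
> normalized new forms that are holomorphic Hecke eigenforms with weight `k` and level `N`, and have
> trivial nebentypus."

"Note that (1.2) improves [Kha21] by explicating the dependence on `k`, and allowing for arbitrary
values of `N` and `q`." (p0002:L40–46: "The condition `1_{M ≪ Q² gcd(M,Q)}` in (1.1) captures the
stability of regular orbital integrals".)

## Lean rendering

* `F_k^{new}(N)` = the tree's `newforms0 N k` (normalised newforms on `Γ₀(N)`, trivial nebentypus;
  by multiplicity one this IS an orthogonal basis of the new subspace consisting of normalised Hecke
  eigenforms — the printed index set); the sum is a `finsum` over that (finite) set.
* `L(1/2, f × χ)` = `IwaniecSarnak.twistedCentralValue f χ` (centre `½` analytic = `k/2` classical).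
* "`≪` with implied constant depending only on `ε`": `∀ ε > 0, ∃ C, ∀ k ≥ 2, N ≥ 1, q ≥ 1, χ primitive`.
* The indicator `1_{N ≪ q² gcd(N,q)}` carries an unprinted absolute constant: rendered as
  `∃ c > 0` (absolute, chosen before `ε`) with the indicator of `N ≤ c · q² · gcd(N,q)`. Since the
  indicator only enlarges the right-hand side, any admissible `c` may be replaced by a larger one; the
  `∃ c` form is exactly as strong as print.
* The exponent `(kNq)^ε` and `k^{1/2}` are real powers of the real casts.

WHAT THIS IS NOT: an asymptotic, a lower bound, or a non-vanishing proportion; nothing here bears on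
the `½` edge except as an a-priori input. «The programme SEARCHES and TYPES; no claim about
Landau–Siegel zeros, Theorems 1–2 of arXiv:2211.02515 or a repaired Margin232 until a kernel theorem
says so.»
-/

noncomputable section

open scoped MatrixGroups
open CongruenceSubgroup Complex
open Literature.NumberTheory.EllipticCurves.ModularForms
open Literature.NumberTheory.LFunctions.IwaniecSarnak

namespace Literature.NumberTheory.LFunctions

namespace YangLiyang2025

/-- **The unweighted second moment `Σ_{f ∈ F_k^{new}(N)} |L(½, f × χ)|²`** over the normalised
newforms of weight `k` and level `Γ₀(N)` (a finite sum: `finite_newforms0_holds`).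
[cite: YangLiyang2025TAMS, Corollary 1.2 (1.2), left-hand side] -/
def secondMoment (N : ℕ) [NeZero N] (k : ℤ) {q : ℕ} (χ : DirichletCharacter ℂ q) : ℝ :=
  ∑ᶠ f ∈ newforms0 N k, ‖twistedCentralValue f χ‖ ^ 2

/-- The second moment is a genuine finite sum over the newforms. [cite: YangLiyang2025TAMS, Corollary 1.2] -/
theorem secondMoment_eq_sum (N : ℕ) [NeZero N] (k : ℤ) {q : ℕ} (χ : DirichletCharacter ℂ q) :
    secondMoment N k χ =
      ∑ f ∈ (finite_newforms0_holds N k).toFinset, ‖twistedCentralValue f χ‖ ^ 2 := by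
  unfold secondMoment
  exact finsum_mem_eq_finite_toFinset_sum _ _

/-- The second moment is non-negative. [cite: YangLiyang2025TAMS, Corollary 1.2] -/
theorem secondMoment_nonneg (N : ℕ) [NeZero N] (k : ℤ) {q : ℕ} (χ : DirichletCharacter ℂ q) :
    0 ≤ secondMoment N k χ :=
  finsum_nonneg fun _ => finsum_nonneg fun _ => by positivity

end YangLiyang2025

open YangLiyang2025

/-- **L. Yang, Corollary 1.2 (uniform second moment of twisted central values over newforms).**
"Let `k ≥ 2` and `N ≥ 1`. Let `χ` be a primitive Dirichlet character modulo `q`. Then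
`Σ_{f ∈ F_k^{new}(N)} |L(1/2, f × χ)|² ≪ (kNq)^ε (kN + k^{1/2} q · 1_{N ≪ q² gcd(N,q)})`, where the
implied constant depends only on `ε`." Rendered: there is an absolute `c > 0` such that for every
`ε > 0` some `C` gives, for all `k ≥ 2`, `N ≥ 1`, `q ≥ 1` and primitive `χ mod q`,
`secondMoment N k χ ≤ C (kNq)^ε (kN + √k · q · [N ≤ c q² gcd(N,q)])`. NAMED FACT, not proved here
(regularised relative trace formula, Theorem A over a number field).
[cite: YangLiyang2025TAMS, Corollary 1.2] -/
def yangLiyang2025_corollary12 : Prop :=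
  ∃ c : ℝ, 0 < c ∧ ∀ eps : ℝ, 0 < eps → ∃ C : ℝ,
    ∀ (N : ℕ) [NeZero N] (k : ℤ), 2 ≤ k → ∀ (q : ℕ) [NeZero q] (χ : DirichletCharacter ℂ q),
      χ.IsPrimitive →
        secondMoment N k χ ≤
          C * ((k : ℝ) * N * q) ^ eps *
            ((k : ℝ) * N + Real.sqrt k * q * (if (N : ℝ) ≤ c * (q : ℝ) ^ 2 * (Nat.gcd N q) then 1 else 0))

/-! ### Proved bookkeeping: the two regimes of the bound -/

/-- Off the stability range (`N > c q² gcd(N,q)`, in particular `N > c q³`) the bound is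
`C (kNq)^ε · kN` — Lindelöf on average over the family of size `≍ kN`.
[cite: YangLiyang2025TAMS, Corollary 1.2] -/
theorem yangLiyang2025_corollary12.large_level (h : yangLiyang2025_corollary12) :
    ∃ c : ℝ, 0 < c ∧ ∀ eps : ℝ, 0 < eps → ∃ C : ℝ,
      ∀ (N : ℕ) [NeZero N] (k : ℤ), 2 ≤ k → ∀ (q : ℕ) [NeZero q] (χ : DirichletCharacter ℂ q),
        χ.IsPrimitive → c * (q : ℝ) ^ 2 * (Nat.gcd N q) < N →
          secondMoment N k χ ≤ C * ((k : ℝ) * N * q) ^ eps * ((k : ℝ) * N) := by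
  obtain ⟨c, hc, h⟩ := h
  refine ⟨c, hc, fun eps heps => ?_⟩
  obtain ⟨C, hC⟩ := h eps heps
  refine ⟨C, fun N _ k hk q _ χ hχ hN => ?_⟩
  have := hC N k hk q χ hχ
  rwa [if_neg (not_le.mpr hN), mul_zero, add_zero] at this

/-- Each single term is bounded by the moment: `|L(½, f × χ)|² ≤ secondMoment N k χ` for a newform
`f` (dropping all but one term, as the source does for Theorem B).
[cite: YangLiyang2025TAMS, §1.2 (first sentence)] -/
theorem YangLiyang2025.norm_sq_le_secondMoment {N : ℕ} [NeZero N] {k : ℤ} {q : ℕ}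
    (χ : DirichletCharacter ℂ q) {f : CuspForm (Gamma0 N) k} (hf : f ∈ newforms0 N k) :
    ‖twistedCentralValue f χ‖ ^ 2 ≤ secondMoment N k χ := by
  classical
  rw [secondMoment_eq_sum]
  refine Finset.single_le_sum (f := fun g => ‖twistedCentralValue g χ‖ ^ 2) (fun _ _ => by positivity)
    ((finite_newforms0_holds N k).mem_toFinset.mpr hf)

end Literature.NumberTheory.LFunctions
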